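import Mathlib
import Summits.KontsevichZagierPeriods.Zeta5Search.Families.BasicGrowthSymmetry
import Summits.KontsevichZagierPeriods.Zeta5Search.Families.RayGrowth
import HarnessLib

/-!
# ζ(5) search — Families: Brown's `PGL₂`-invariance under homogeneity, dihedral part, for every exponent RAY

HONEST FRAMING: systematic search; no irrationality claim unless certified.  STRUCTURAL (size of cellular integrals);
nothing about the arithmetic of any zeta value.  Seat P2, Families layer.

[Brown2016, §5.1] states that under the homogeneity equations (5.2) the generalised cellular integrand
`f_σ(a,b) ω_σ` is `PGL₂`-invariant.  `Families/BasicGrowthSymmetry.lean` proved the dihedral relabelling invariance of the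
growth constant for the BASIC ray (all exponents equal).  Here the cyclic relabelling `z_k ↦ z_{k+1}` is done for an
ARBITRARY homogeneous integer ray `(α, β)`:

* `Homogeneous.rotate` — homogeneity of `(σ, α, β)` passes to the relabelled triple `(σ + 1, α(· − 1), β)`;
* `sum_eq_of_homogeneous` — `Σ α = Σ β` for a bijective homogeneous triple;
* **`rayF_rotate`** — for bijective `σ`, homogeneous `(α, β)` and `t` in the open simplex,
  `f_{σ+1}(α(·−1), β)(t) = f_σ(α, β)(rotT t)` (the Möbius change of variables `z ↦ 1 − t_1/z` of
  `BasicGrowthSymmetry`; the vertex weights `ω` now cancel BECAUSE of (5.2): the weight of the vertex `σ_i + 1` appears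
  with exponent `β_{i−1} + β_i` below and `α_{σ_i − 1} + α_{σ_i}` above);
* **`raySup_rotate`** — `M_{σ+1}(α(·−1), β) = M_σ(α, β)` with NO convergence hypothesis (the two image sets coincide:
  `⊆` by the change of variables, `⊇` by iterating it `n = ℓ + 3` times).
Standard axioms only.
-/

noncomputable section

open Finset

namespace Summit.KontsevichZagierPeriods.Zeta5Search.Families.Cellular

variable {ℓ : ℕ} (σ : Fin (ℓ + 3) → Fin (ℓ + 3)) (α β : Fin (ℓ + 3) → ℤ)

/-! ### Homogeneity bookkeeping -/

/-- Homogeneity passes to the relabelled triple `(σ + 1, α(· − 1), β)`. -/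
theorem Homogeneous.rotate (hh : Homogeneous σ α β) :
    Homogeneous (fun i => σ i + 1) (fun i => α (i - 1)) β := by
  intro i
  show α (σ i + 1 - 1 - 1) + α (σ i + 1 - 1) = β (i - 1) + β i
  rw [add_sub_cancel_right]
  exact hh i

/-- For a bijective homogeneous triple the exponent sums agree: `Σ α = Σ β`. -/
theorem sum_eq_of_homogeneous (hσ : Function.Bijective σ) (hh : Homogeneous σ α β) :
    ∑ i, α i = ∑ i, β i := by
  have h1 : ∑ i, (α (σ i - 1) + α (σ i)) = ∑ i, (β (i - 1) + β i) :=
    Finset.sum_congr rfl fun i _ => hh i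
  rw [sum_add_distrib, sum_add_distrib] at h1
  have e1 : ∑ i, α (σ i) = ∑ i, α i := Fintype.sum_equiv (Equiv.ofBijective σ hσ) _ _ fun i => rfl
  have e2 : ∑ i, α (σ i - 1) = ∑ i, α i :=
    Fintype.sum_equiv ((Equiv.ofBijective σ hσ).trans (Equiv.subRight 1)) _ _ fun i => rfl
  have e3 : ∑ i : Fin (ℓ + 3), β (i - 1) = ∑ i, β i := Fintype.sum_equiv (Equiv.subRight 1) _ _ fun i => rfl
  rw [e1, e2, e3] at h1
  linarith

/-- `∏ a^{f i} = a^{Σ f}` for `a ≠ 0` (integer exponents; a private copy of a generic helper). -/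
private theorem prod_zpow_eq_zpow_sum {ι : Type*} (s : Finset ι) (f : ι → ℤ) {a : ℝ} (ha : a ≠ 0) :
    ∏ i ∈ s, a ^ f i = a ^ ∑ i ∈ s, f i := by
  classical
  induction s using Finset.induction_on with
  | empty => simp
  | insert j s hj ih => rw [prod_insert hj, sum_insert hj, ih, zpow_add₀ ha]

variable {σ α β}

/-! ### The change of variables on a general ray -/

/-- The edge law of the Möbius map in quotient form. -/
theorem ef_rotT_eq {t : Fin ℓ → ℝ} (ht : t ∈ openSimplex ℓ) {u v : Fin (ℓ + 3)} (huv : u ≠ v) :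
    ef (rotT t) u v = ef t (u + 1) (v + 1) * pt t 1 / (rotW t (u + 1) * rotW t (v + 1)) := by
  rw [eq_div_iff (mul_ne_zero (rotW_pos ht _).ne' (rotW_pos ht _).ne')]
  exact ef_rotT_mul ht huv

/-- **`f_{σ+1}(α(·−1), β)(t) = f_σ(α, β)(rotT t)`** for a bijective seating and homogeneous exponents. -/
theorem rayF_rotate (hσ : Function.Bijective σ) (hh : Homogeneous σ α β) {t : Fin ℓ → ℝ}
    (ht : t ∈ openSimplex ℓ) :
    rayF (fun i => σ i + 1) (fun i => α (i - 1)) β t = rayF σ α β (rotT t) := by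
  have h1 : pt t 1 ≠ 0 := (pt_pos_of_pos ht le_rfl).ne'
  have hW : ∀ x, rotW t x ≠ 0 := fun x => (rotW_pos ht x).ne'
  -- numerator and denominator after the change of variables
  have hnum : num α (rotT t) = (∏ i : Fin (ℓ + 3), ef t (i + 1) (i + 1 + 1) ^ α i) *
      (∏ i : Fin (ℓ + 3), pt t 1 ^ α i) /
      ((∏ i : Fin (ℓ + 3), rotW t (i + 1) ^ α i) * ∏ i : Fin (ℓ + 3), rotW t (i + 1 + 1) ^ α i) := by
    unfold num
    rw [← prod_mul_distrib, ← prod_mul_distrib, ← prod_div_distrib]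
    refine prod_congr rfl fun i _ => ?_
    rw [ef_rotT_eq ht (succ_ne_self i), div_zpow, mul_zpow, mul_zpow]
  have hden : den σ β (rotT t) = (∏ i : Fin (ℓ + 3), ef t (σ i + 1) (σ (i + 1) + 1) ^ β i) *
      (∏ i : Fin (ℓ + 3), pt t 1 ^ β i) /
      ((∏ i : Fin (ℓ + 3), rotW t (σ i + 1) ^ β i) * ∏ i : Fin (ℓ + 3), rotW t (σ (i + 1) + 1) ^ β i) := by
    unfold den
    rw [← prod_mul_distrib, ← prod_mul_distrib, ← prod_div_distrib]
    refine prod_congr rfl fun i _ => ?_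
    rw [ef_rotT_eq ht (fun e => succ_ne_self i (hσ.1 e)), div_zpow, mul_zpow, mul_zpow]
  -- the powers of `t_1` agree: `Σ α = Σ β`
  have hT : ∏ i : Fin (ℓ + 3), pt t 1 ^ α i = ∏ i : Fin (ℓ + 3), pt t 1 ^ β i := by
    rw [prod_zpow_eq_zpow_sum _ _ h1, prod_zpow_eq_zpow_sum _ _ h1, sum_eq_of_homogeneous σ α β hσ hh]
  -- the weights agree, by homogeneity: both equal `∏_x ω(x+1)^{α_x + α_{x−1}}`
  have hWa : (∏ i : Fin (ℓ + 3), rotW t (i + 1) ^ α i) * (∏ i : Fin (ℓ + 3), rotW t (i + 1 + 1) ^ α i) =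
      ∏ x : Fin (ℓ + 3), rotW t (x + 1) ^ (α x + α (x - 1)) := by
    have e : ∏ i : Fin (ℓ + 3), rotW t (i + 1 + 1) ^ α i = ∏ x : Fin (ℓ + 3), rotW t (x + 1) ^ α (x - 1) :=
      Fintype.prod_equiv (Equiv.addRight 1) _ _ fun i => by
        show rotW t (i + 1 + 1) ^ α i = rotW t (i + 1 + 1) ^ α (i + 1 - 1)
        rw [add_sub_cancel_right]
    rw [e, ← prod_mul_distrib]
    refine prod_congr rfl fun x _ => ?_
    rw [zpow_add₀ (hW _)]
  have hWb : (∏ i : Fin (ℓ + 3), rotW t (σ i + 1) ^ β i) * (∏ i : Fin (ℓ + 3), rotW t (σ (i + 1) + 1) ^ β i) =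
      ∏ x : Fin (ℓ + 3), rotW t (x + 1) ^ (α x + α (x - 1)) := by
    have e : ∏ i : Fin (ℓ + 3), rotW t (σ (i + 1) + 1) ^ β i = ∏ j : Fin (ℓ + 3), rotW t (σ j + 1) ^ β (j - 1) :=
      Fintype.prod_equiv (Equiv.addRight 1) _ _ fun i => by
        show rotW t (σ (i + 1) + 1) ^ β i = rotW t (σ (i + 1) + 1) ^ β (i + 1 - 1)
        rw [add_sub_cancel_right]
    rw [e, ← prod_mul_distrib]
    have e2 : ∏ i : Fin (ℓ + 3), rotW t (σ i + 1) ^ β i * rotW t (σ i + 1) ^ β (i - 1) =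
        ∏ i : Fin (ℓ + 3), rotW t (σ i + 1) ^ (α (σ i) + α (σ i - 1)) := by
      refine prod_congr rfl fun i _ => ?_
      rw [← zpow_add₀ (hW _), show β i + β (i - 1) = α (σ i) + α (σ i - 1) by have := hh i; linarith]
    rw [e2]
    exact Fintype.prod_equiv (Equiv.ofBijective σ hσ) _ (fun x => rotW t (x + 1) ^ (α x + α (x - 1))) fun i => rfl
  -- the numerators agree after reindexing
  have hA : ∏ j : Fin (ℓ + 3), ef t j (j + 1) ^ α (j - 1) = ∏ i : Fin (ℓ + 3), ef t (i + 1) (i + 1 + 1) ^ α i :=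
    (Fintype.prod_equiv (Equiv.addRight 1) _ _ fun i => by
      show ef t (i + 1) (i + 1 + 1) ^ α i = ef t (i + 1) (i + 1 + 1) ^ α (i + 1 - 1)
      rw [add_sub_cancel_right]).symm
  -- assemble
  have hK : (∏ i : Fin (ℓ + 3), pt t 1 ^ β i) / ∏ x : Fin (ℓ + 3), rotW t (x + 1) ^ (α x + α (x - 1)) ≠ 0 :=
    div_ne_zero (prod_ne_zero_iff.2 fun i _ => zpow_ne_zero _ h1)
      (prod_ne_zero_iff.2 fun x _ => zpow_ne_zero _ (hW _))
  have key : ∀ A B T W : ℝ, T / W ≠ 0 → A * T / W / (B * T / W) = A / B := fun A B T W h => by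
    rw [show A * T / W = A * (T / W) by ring, show B * T / W = B * (T / W) by ring, mul_div_mul_right _ _ h]
  unfold rayF
  rw [hnum, hden, hT, hWa, hWb, key _ _ _ _ hK]
  unfold num den
  rw [hA]

/-- The image sets of `f` over the simplex: the relabelled ray's is contained in the original's. -/
theorem image_rayF_rotate_subset (hσ : Function.Bijective σ) (hh : Homogeneous σ α β) :
    rayF (fun i => σ i + 1) (fun i => α (i - 1)) β '' openSimplex ℓ ⊆ rayF σ α β '' openSimplex ℓ := by
  rintro _ ⟨t, ht, rfl⟩
  exact ⟨rotT t, rotT_mem ht, (rayF_rotate hσ hh ht).symm⟩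

/-- Iterating the relabelling `k` times: seating `σ + k·1`, exponents `α(· − k·1)`. -/
theorem image_rayF_iterate_subset (hσ : Function.Bijective σ) (hh : Homogeneous σ α β) (k : ℕ) :
    rayF (fun i => σ i + k • (1 : Fin (ℓ + 3))) (fun i => α (i - k • (1 : Fin (ℓ + 3)))) β '' openSimplex ℓ ⊆
      rayF σ α β '' openSimplex ℓ := by
  induction k with
  | zero => simp
  | succ k ih =>
    have hb := bijective_add_const σ hσ (k • (1 : Fin (ℓ + 3)))
    have hk : Homogeneous (fun i => σ i + k • (1 : Fin (ℓ + 3))) (fun i => α (i - k • (1 : Fin (ℓ + 3)))) β := by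
      clear ih hb
      induction k with
      | zero => simpa using hh
      | succ k ih2 =>
        have := Homogeneous.rotate _ _ _ ih2
        convert this using 2 with i i
        · rw [succ_nsmul, add_assoc]
        · rw [succ_nsmul', sub_add_eq_sub_sub]
    have step := image_rayF_rotate_subset hb hk
    refine Set.Subset.trans (subset_of_eq ?_) (step.trans ih)
    congr 1
    funext t
    congr 1
    · funext i; rw [succ_nsmul, add_assoc]
    · funext i; rw [succ_nsmul', sub_add_eq_sub_sub]

/-- **`M_{σ+1}(α(·−1), β) = M_σ(α, β)`** for every bijective seating and homogeneous exponents — no convergence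
hypothesis (equality of the image sets). -/
theorem raySup_rotate (hσ : Function.Bijective σ) (hh : Homogeneous σ α β) :
    raySup (fun i => σ i + 1) (fun i => α (i - 1)) β = raySup σ α β := by
  unfold raySup
  congr 1
  refine Set.Subset.antisymm (image_rayF_rotate_subset hσ hh) ?_
  -- iterate `ℓ + 2` more times starting from the relabelled triple: back to `(σ, α, β)`
  have h := image_rayF_iterate_subset (bijective_add_const σ hσ 1) (Homogeneous.rotate σ α β hh) (ℓ + 2)
  have hn : (ℓ + 2 + 1) • (1 : Fin (ℓ + 3)) = 0 := by
    have h0 : Fintype.card (Fin (ℓ + 3)) • (1 : Fin (ℓ + 3)) = 0 := card_nsmul_eq_zero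
    rwa [Fintype.card_fin] at h0
  have e1 : (fun i => σ i + 1 + (ℓ + 2) • (1 : Fin (ℓ + 3))) = σ := by
    funext i
    rw [add_assoc, ← succ_nsmul', hn, add_zero]
  have e2 : (fun i => α (i - (ℓ + 2) • (1 : Fin (ℓ + 3)) - 1)) = α := by
    funext i
    rw [sub_sub, ← succ_nsmul, hn, sub_zero]
  rw [e1, e2] at h
  exact h

/-! ## Appended (P2 g4): the remaining dihedral generators for rays — positions and the label reflection

With `raySup_rotate` above: the growth constant `M_σ(α, β)` of every homogeneous ray is a class function for the
dihedral relabellings on both sides (Brown's census classes), extending `BasicGrowthSymmetry` (the ray `α = β = 1`).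
The generators below need no hypothesis at all. -/

/-! ### Domain relabellings of a ray -/

variable (σ α β)

/-- Shifting the positions: `f_{σ(·+1)}(α, β(·+1)) = f_σ(α, β)` pointwise. -/
theorem rayF_shift (t : Fin ℓ → ℝ) : rayF (fun i => σ (i + 1)) α (fun i => β (i + 1)) t = rayF σ α β t := by
  unfold rayF den
  congr 1
  exact Fintype.prod_equiv (Equiv.addRight 1) _ _ fun i => rfl

/-- Reversing the positions: `f_{σ(−·)}(α, β(−·−1)) = f_σ(α, β)` pointwise. -/
theorem rayF_reverse (t : Fin ℓ → ℝ) : rayF (fun i => σ (-i)) α (fun i => β (-(i + 1))) t = rayF σ α β t := by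
  unfold rayF den
  congr 1
  refine Fintype.prod_equiv ((Equiv.addRight (1 : Fin (ℓ + 3))).trans (Equiv.neg _)) _ _ fun i => ?_
  show ef t (σ (-i)) (σ (-(i + 1))) ^ β (-(i + 1)) = ef t (σ (-(i + 1))) (σ (-(i + 1) + 1)) ^ β (-(i + 1))
  rw [show -(i + 1) + 1 = -i by abel, ef_comm]

/-- `M_{σ(·+1)}(α, β(·+1)) = M_σ(α, β)`. -/
theorem raySup_shift : raySup (fun i => σ (i + 1)) α (fun i => β (i + 1)) = raySup σ α β := by
  have h : rayF (fun i => σ (i + 1)) α (fun i => β (i + 1)) = rayF σ α β := funext (rayF_shift σ α β)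
  simp only [raySup, h]

/-- `M_{σ(−·)}(α, β(−·−1)) = M_σ(α, β)`. -/
theorem raySup_reverse : raySup (fun i => σ (-i)) α (fun i => β (-(i + 1))) = raySup σ α β := by
  have h : rayF (fun i => σ (-i)) α (fun i => β (-(i + 1))) = rayF σ α β := funext (rayF_reverse σ α β)
  simp only [raySup, h]

/-! ### Label reflection `z ↦ 1 − z` of a ray (no hypothesis) -/

/-- Reflection of the POSITIONS of the `δ⁰`-edges induced by `z ↦ 1 − z`: the finite edge `{i, i+1}` (`i ≤ ℓ`) goes to
`{ℓ+1−i, ℓ−i}`, i.e. to position `ℓ − i`; the two edges through `∞` are exchanged. -/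
def reflPos (i : Fin (ℓ + 3)) : Fin (ℓ + 3) :=
  if i.val ≤ ℓ then ⟨ℓ - i.val, by omega⟩ else if i.val = ℓ + 1 then ⟨ℓ + 2, by omega⟩ else ⟨ℓ + 1, by omega⟩

/-- The numerator transforms by `reflPos`: `num (α ∘ reflPos) (reflT t) = num α t`. -/
theorem num_reflect (t : Fin ℓ → ℝ) : num (fun i => α (reflPos i)) (reflT t) = num α t := by
  rw [num_eq_prod_subtype, num_eq_prod_subtype]
  let e : DEdge ℓ ≃ DEdge ℓ :=
    { toFun := fun i => ⟨⟨ℓ - i.1.val, by omega⟩, by simp⟩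
      invFun := fun i => ⟨⟨ℓ - i.1.val, by omega⟩, by simp⟩
      left_inv := fun i => Subtype.ext (Fin.ext (by have := i.2; show ℓ - (ℓ - i.1.val) = i.1.val; omega))
      right_inv := fun i => Subtype.ext (Fin.ext (by have := i.2; show ℓ - (ℓ - i.1.val) = i.1.val; omega)) }
  refine Fintype.prod_equiv e _ _ fun i => ?_
  have hi : i.1.val ≤ ℓ := i.2
  have h1 : reflPos i.1 = ⟨ℓ - i.1.val, by omega⟩ := by simp [reflPos, hi]
  show (pt (reflT t) (i.1.val + 1) - pt (reflT t) i.1.val) ^ α (reflPos i.1) =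
    (pt t (ℓ - i.1.val + 1) - pt t (ℓ - i.1.val)) ^ α ⟨ℓ - i.1.val, by omega⟩
  rw [h1]
  congr 1
  have h2 := gapN_reflT t hi
  simp only [gapN] at h2
  exact h2

/-- The denominator is reflection invariant: `den (reflIdx ∘ σ) β (reflT t) = den σ β t`. -/
theorem den_reflect (t : Fin ℓ → ℝ) : den (fun i => reflIdx (σ i)) β (reflT t) = den σ β t := by
  unfold den
  exact Finset.prod_congr rfl fun i _ => by rw [ef_reflT]

/-- **`f_{reflIdx ∘ σ}(α ∘ reflPos, β)(reflT t) = f_σ(α, β)(t)`** — no hypothesis. -/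
theorem rayF_reflect (t : Fin ℓ → ℝ) :
    rayF (fun i => reflIdx (σ i)) (fun i => α (reflPos i)) β (reflT t) = rayF σ α β t := by
  unfold rayF
  rw [num_reflect, den_reflect]

/-- **`M_{reflIdx ∘ σ}(α ∘ reflPos, β) = M_σ(α, β)`** — reflection invariance of the growth constant of every ray. -/
theorem raySup_reflect : raySup (fun i => reflIdx (σ i)) (fun i => α (reflPos i)) β = raySup σ α β := by
  unfold raySup
  congr 1
  ext y
  constructor
  · rintro ⟨t, ht, rfl⟩
    exact ⟨reflT t, reflT_mem ht, by rw [← rayF_reflect σ α β (reflT t), reflT_reflT]⟩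
  · rintro ⟨t, ht, rfl⟩
    exact ⟨reflT t, reflT_mem ht, rayF_reflect σ α β t⟩

/-! ## Appended (P2 g4): homogeneity is preserved by the label reflection -/

/-- Values of `reflIdx`. -/
theorem reflIdx_val (u : Fin (ℓ + 3)) : (reflIdx u).val = if u.val = ℓ + 2 then ℓ + 2 else ℓ + 1 - u.val := by
  by_cases h : u.val = ℓ + 2
  · rw [reflIdx_of_eq h, if_pos h, h]
  · rw [reflIdx_val_of_ne h, if_neg h]

/-- Values of `reflPos`. -/
theorem reflPos_val (i : Fin (ℓ + 3)) :
    (reflPos i).val = if i.val ≤ ℓ then ℓ - i.val else if i.val = ℓ + 1 then ℓ + 2 else ℓ + 1 := by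
  unfold reflPos
  split_ifs <;> rfl

/-- `reflPos (reflIdx x) = x − 1`: the reflected vertex `x` is the upper end of the reflected edge at position `x − 1`. -/
theorem reflPos_reflIdx (x : Fin (ℓ + 3)) : reflPos (reflIdx x) = x - 1 := by
  apply Fin.ext
  have hx := x.isLt
  have h0 : ((x - 1 : Fin (ℓ + 3)) : ℕ) = if x = 0 then ℓ + 2 else (x : ℕ) - 1 := Fin.coe_sub_one x
  rw [reflPos_val, reflIdx_val, h0]
  by_cases hz : x = 0
  · subst hz
    simp
  · have hz' : (x : ℕ) ≠ 0 := fun e => hz (Fin.ext (by rw [e]; rfl))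
    rw [if_neg hz]
    split_ifs <;> omega

/-- `reflPos (reflIdx x − 1) = x`. -/
theorem reflPos_reflIdx_sub_one (x : Fin (ℓ + 3)) : reflPos (reflIdx x - 1) = x := by
  apply Fin.ext
  have hx := x.isLt
  have hval := reflIdx_val x
  by_cases hz : reflIdx x = 0
  · have e : ((reflIdx x - 1 : Fin (ℓ + 3)) : ℕ) = ℓ + 2 := by rw [Fin.coe_sub_one, if_pos hz]
    have h0 : (reflIdx x).val = 0 := by rw [hz]; rfl
    rw [h0] at hval
    rw [reflPos_val, e]
    split_ifs at hval ⊢ <;> omega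
  · have e : ((reflIdx x - 1 : Fin (ℓ + 3)) : ℕ) = (reflIdx x).val - 1 := by rw [Fin.coe_sub_one, if_neg hz]
    have hne : (reflIdx x).val ≠ 0 := fun h => hz (Fin.ext (by rw [h]; rfl))
    rw [hval] at hne
    rw [reflPos_val, e, hval]
    split_ifs at hne ⊢ <;> omega

/-- **Homogeneity is preserved by the label reflection**: `(reflIdx ∘ σ, α ∘ reflPos, β)` is homogeneous when
`(σ, α, β)` is — so `raySup_reflect` composes with `raySup_rotate`. -/
theorem Homogeneous.reflect (hh : Homogeneous σ α β) :
    Homogeneous (fun i => reflIdx (σ i)) (fun i => α (reflPos i)) β := by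
  intro i
  show α (reflPos (reflIdx (σ i) - 1)) + α (reflPos (reflIdx (σ i))) = β (i - 1) + β i
  rw [reflPos_reflIdx_sub_one, reflPos_reflIdx, add_comm]
  exact hh i

/-! ## Appended (P2 g4): iterated rotations -/

/-- Homogeneity passes to the `k`-fold relabelled triple `(σ + k·1, α(· − k·1), β)`. -/
theorem Homogeneous.rotate_nsmul (hh : Homogeneous σ α β) (k : ℕ) :
    Homogeneous (fun i => σ i + k • (1 : Fin (ℓ + 3))) (fun i => α (i - k • (1 : Fin (ℓ + 3)))) β := by
  induction k with
  | zero => simpa using hh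
  | succ k ih =>
    have := Homogeneous.rotate _ _ _ ih
    convert this using 2 with i i
    · rw [succ_nsmul, add_assoc]
    · rw [succ_nsmul', sub_add_eq_sub_sub]

variable {σ α β} in
/-- **`M_{σ + k·1}(α(· − k·1), β) = M_σ(α, β)`** for every `k` (bijective `σ`, homogeneous `(α, β)`). -/
theorem raySup_add_nsmul (hσ : Function.Bijective σ) (hh : Homogeneous σ α β) (k : ℕ) :
    raySup (fun i => σ i + k • (1 : Fin (ℓ + 3))) (fun i => α (i - k • (1 : Fin (ℓ + 3)))) β = raySup σ α β := by
  induction k with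
  | zero => simp
  | succ k ih =>
    rw [← ih, ← raySup_rotate (bijective_add_const σ hσ (k • (1 : Fin (ℓ + 3)))) (Homogeneous.rotate_nsmul σ α β hh k)]
    congr 1
    · funext i
      show σ i + (k + 1) • (1 : Fin (ℓ + 3)) = σ i + k • (1 : Fin (ℓ + 3)) + 1
      rw [succ_nsmul, add_assoc]
    · funext i
      show α (i - (k + 1) • (1 : Fin (ℓ + 3))) = α (i - 1 - k • (1 : Fin (ℓ + 3)))
      rw [succ_nsmul', sub_add_eq_sub_sub]

end Summit.KontsevichZagierPeriods.Zeta5Search.Families.Cellular
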